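import Summits.Parity.GeneralizedHardyLittlewood.Theorems.LeeYangFibresCellsToRelativeDimOneCounts
import Literature.NumberTheory.Sieve.LinearEquationsInPrimesDimOne
import Literature.NumberTheory.Sieve.LinearEquationsInPrimesOneForm
import Literature.NumberTheory.Sieve.LinearEquationsInPrimesSingularSeries
import Literature.NumberTheory.Sieve.SingularSeries
import HarnessLib

/-!
# Dictionary: the translate system of a tuple `H` as Green–Tao data (crux stmt-Parity-14112)

Route-file-free dictionary for the hardness certificate
`PrimeCellsRelative → HardyLittlewoodTuples` (crux stmt-Parity-14112 of route `LeeYangFibres`,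
Parity / GeneralizedHardyLittlewood, line `Sketch`): for a finite tuple `H ⊆ ℤ`, enumerated as
`hⱼ = H.equivFin⁻¹ j`, the one-dimensional system `ψⱼ(n) = n + hⱼ` (`j < #H`) satisfies

* `isNondegenerateSystem_shift` — non-degenerate in Green–Tao's sense (distinct shifts);
* `goodCount_shift_add`, `localFactor_shift_eq_singularSeriesFactor`,
  `singularProduct_shift_eq_singularSeries` — `β_p = (1 - ν_H(p)/p)(1 - 1/p)^{-k}` factor by factor,
  so Green–Tao's singular product IS the Hardy–Littlewood singular series `𝔖(H)` (same ordered
  partial products, no convergence needed);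
* `affLinSize_shift_le` — `‖Ψ‖_N ≤ k + k·max|hⱼ|`;
* `archFactor_shift_bounds` — on `K = [1, x]`, `x - (max|hⱼ| + 1) ≤ β_∞ ≤ x`;
* `primeTupleCount_eq_primePointCount` — `π_H(x)` is Green–Tao's prime-point count of the system
  on `[1, x]`.

References: G. H. Hardy, J. E. Littlewood, Acta Math. 44 (1923), Conjecture B / Theorem X 1
[HardyLittlewood1923]; B. Green, T. Tao, Ann. of Math. 171 (2010), Def. 1.1, Example 1, (1.4),
(1.6)–(1.7) [GreenTao2010].
-/

noncomputable section

namespace Summit.Parity.GeneralizedHardyLittlewood.Cruxes.PrimeCellsRelative.Sketch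

open scoped BigOperators Topology Classical
open Filter Finset MeasureTheory Literature.NumberTheory.Sieve
open Summit.Parity.GeneralizedHardyLittlewood.Theorems.LeeYangFibresCells

variable {k : ℕ}

/-! ### The translate system `(n + hⱼ)ⱼ` as Green–Tao data -/

/-- `ψⱼ(n) = n₀ + hⱼ`. [folklore] -/
theorem shift_eval (h : Fin k → ℤ) (j : Fin k) (n : Fin 1 → ℤ) :
    ((fun j => (⟨fun _ => (1 : ℤ), h j⟩ : AffLinForm 1)) j).eval n = n 0 + h j := by
  rw [DimOne.eval_eq]; simp

/-- **Non-degeneracy of the translate system**: for pairwise distinct shifts the forms `n + hⱼ`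
are non-constant and pairwise non-proportional (`A (n + hᵢ) = B (n + hⱼ)` for all `n` forces
`A = B` and then `A (hᵢ - hⱼ) = 0`). [cite: GreenTao2010, Def. 1.1] -/
theorem isNondegenerateSystem_shift (h : Fin k → ℤ) (hinj : Function.Injective h) :
    IsNondegenerateSystem (fun j => (⟨fun _ => (1 : ℤ), h j⟩ : AffLinForm 1)) := by
  refine ⟨fun i h0 => ?_, fun i j hij A B hAB => ?_⟩
  · have := congr_fun h0 0
    simp at this
  · have e0 := hAB (fun _ => 0)
    have e1 := hAB (fun _ => 1)
    simp only [shift_eval, zero_add] at e0 e1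
    have hAB' : A = B := by linear_combination e1 - e0
    subst hAB'
    have hne : h i ≠ h j := fun h' => hij (hinj h')
    have hA : A = 0 := by
      by_contra hA
      exact hne (mul_left_cancel₀ hA e0)
    exact ⟨hA, hA⟩

/-- **Good residues of the translate system**: `#{x mod p : x + hⱼ ≢ 0 ∀ j} + #{hⱼ mod p} = p`.
[cite: GreenTao2010, proof of Lemma 1.3] -/
theorem goodCount_shift_add (h : Fin k → ℤ) (p : ℕ) [hp : Fact p.Prime] :
    goodCount (fun j => (⟨fun _ => (1 : ℤ), h j⟩ : AffLinForm 1)) p +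
      #(Finset.univ.image fun j => (h j : ZMod p)) = p := by
  have hgood : goodCount (fun j => (⟨fun _ => (1 : ℤ), h j⟩ : AffLinForm 1)) p =
      #{x : ZMod p | ∀ j, ¬ (x + (h j : ZMod p) = 0)} := by
    unfold goodCount
    rw [← OneForm.card_filter_fin_one (fun x : ZMod p => ∀ j, ¬ (x + (h j : ZMod p) = 0))]
    congr 1
    ext v
    simp only [Finset.mem_filter, Finset.mem_univ, true_and, OneForm.modEval_eq, Int.cast_one,
      one_mul]
  have hbad : (Finset.univ.filter fun x : ZMod p => ¬ ∀ j, ¬ (x + (h j : ZMod p) = 0)) =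
      (Finset.univ.image fun j => (h j : ZMod p)).image Neg.neg := by
    ext x
    simp only [Finset.mem_filter, Finset.mem_univ, true_and, not_forall, not_not,
      Finset.mem_image, exists_exists_eq_and]
    constructor
    · rintro ⟨j, hj⟩; exact ⟨j, (eq_neg_of_add_eq_zero_left hj).symm⟩
    · rintro ⟨j, hj⟩; exact ⟨j, by rw [← hj, neg_add_cancel]⟩
  have hcard : #((Finset.univ.image fun j => (h j : ZMod p)).image Neg.neg) =
      #(Finset.univ.image fun j => (h j : ZMod p)) :=
    Finset.card_image_of_injective _ neg_injective
  have hsum := Finset.card_filter_add_card_filter_not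
    (s := (Finset.univ : Finset (ZMod p))) (fun x : ZMod p => ∀ j, ¬ (x + (h j : ZMod p) = 0))
  rw [hbad, hcard, Finset.card_univ, ZMod.card] at hsum
  rw [hgood]
  exact hsum

/-- The residues occupied by an enumeration of `H` are those occupied by `H`:
`#{hⱼ mod p} = ν_H(p)` for `h = H.equivFin⁻¹`. [folklore] -/
theorem card_image_equivFin_eq_tupleResidueCount (H : Finset ℤ) (p : ℕ) :
    #(Finset.univ.image fun j : Fin H.card => (((H.equivFin.symm j : H) : ℤ) : ZMod p)) =
      tupleResidueCount H p := by
  unfold tupleResidueCount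
  congr 1
  ext x
  simp only [Finset.mem_image, Finset.mem_univ, true_and]
  constructor
  · rintro ⟨j, rfl⟩
    exact ⟨_, (H.equivFin.symm j).2, rfl⟩
  · rintro ⟨y, hy, rfl⟩
    exact ⟨H.equivFin ⟨y, hy⟩, by simp⟩

/-- **Factor by factor, Green–Tao's local factor of the translate system of `H` is the
Hardy–Littlewood Euler factor of `𝔖(H)`**: `β_p = p⁻¹ (p/(p-1))^k (p - ν_H(p)) =
(1 - ν_H(p)/p)(1 - 1/p)^{-k}`. [cite: GreenTao2010, Example 1 and (1.6)] -/
theorem localFactor_shift_eq_singularSeriesFactor (H : Finset ℤ) {p : ℕ} (hp : p.Prime) :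
    localFactor (fun j : Fin H.card =>
        (⟨fun _ => (1 : ℤ), ((H.equivFin.symm j : H) : ℤ)⟩ : AffLinForm 1)) p =
      singularSeriesFactor H p := by
  haveI := Fact.mk hp
  have hp1 : (1 : ℝ) < p := by exact_mod_cast hp.one_lt
  have hp0 : (p : ℝ) ≠ 0 := by positivity
  have hpm : (p : ℝ) - 1 ≠ 0 := by linarith
  have hg := goodCount_shift_add (fun j : Fin H.card => ((H.equivFin.symm j : H) : ℤ)) p
  rw [card_image_equivFin_eq_tupleResidueCount] at hg
  have hg' : (goodCount (fun j : Fin H.card =>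
      (⟨fun _ => (1 : ℤ), ((H.equivFin.symm j : H) : ℤ)⟩ : AffLinForm 1)) p : ℝ) =
      p - tupleResidueCount H p := by
    rw [eq_sub_iff_add_eq]; exact_mod_cast hg
  rw [localFactor_prime, hg', singularSeriesFactor, pow_one]
  have h1 : (1 - 1 / (p : ℝ))⁻¹ = p / (p - 1) := by
    field_simp
  rw [h1]
  field_simp

/-- **`∏_p β_p = 𝔖(H)` for the translate system of `H`**: the ordered partial products agree term
by term, hence so do their `limUnder`s. [cite: GreenTao2010, Example 1 and (1.7)] -/
theorem singularProduct_shift_eq_singularSeries (H : Finset ℤ) :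
    singularProduct (fun j : Fin H.card =>
        (⟨fun _ => (1 : ℤ), ((H.equivFin.symm j : H) : ℤ)⟩ : AffLinForm 1)) =
      singularSeries H := by
  unfold singularSeries singularProduct
  congr 1
  funext x
  unfold singularSeriesPartial singularProductPartial
  exact Finset.prod_congr rfl fun p hp =>
    localFactor_shift_eq_singularSeriesFactor H (Nat.mem_primesLE.mp hp).2

/-- `‖Ψ‖_N ≤ k + k T` for `N ≥ 1`, where `T` bounds the shifts `|hⱼ| ≤ T`. [cite: GreenTao2010, (1.1)] -/
theorem affLinSize_shift_le (h : Fin k → ℤ) {T : ℕ} (hT : ∀ j, (h j).natAbs ≤ T) {N : ℕ}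
    (hN : 1 ≤ N) :
    affLinSize (fun j => (⟨fun _ => (1 : ℤ), h j⟩ : AffLinForm 1)) N ≤ ((k + k * T : ℕ) : ℝ) := by
  unfold affLinSize
  have hN1 : (1 : ℝ) ≤ N := by exact_mod_cast hN
  push_cast
  have h1 : ∑ i : Fin k, ∑ _j : Fin 1, |((1 : ℤ) : ℝ)| = k := by simp
  have h2 : ∑ i : Fin k, |((h i : ℤ) : ℝ) / N| ≤ k * T := by
    calc ∑ i : Fin k, |((h i : ℤ) : ℝ) / N| ≤ ∑ _i : Fin k, (T : ℝ) := by
          refine Finset.sum_le_sum fun i _ => ?_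
          rw [abs_div, Nat.abs_cast]
          refine (div_le_self (abs_nonneg _) hN1).trans ?_
          rw [← Int.cast_abs, Int.abs_eq_natAbs]
          exact_mod_cast hT i
      _ = k * T := by simp
  simpa [h1] using h2

/-- **The archimedean factor of the translate system on `[1, x]`**: the slice
`{1 ≤ r ≤ x : r + hⱼ > 0 ∀ j}` lies between `(T + 1, x]` and `[1, x]` when `|hⱼ| ≤ T`, so
`x - (T + 1) ≤ β_∞ ≤ x` for `x ≥ T + 1`. [cite: GreenTao2010, (1.4)] -/
theorem archFactor_shift_bounds (h : Fin k → ℤ) {T : ℕ} (hT : ∀ j, (h j).natAbs ≤ T) {x : ℕ}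
    (hx : T + 1 ≤ x) :
    (x : ℝ) - (T + 1) ≤ archFactor (fun j => (⟨fun _ => (1 : ℤ), h j⟩ : AffLinForm 1))
        (Set.Icc (fun _ : Fin 1 => (1 : ℝ)) (fun _ => (x : ℝ))) ∧
      archFactor (fun j => (⟨fun _ => (1 : ℤ), h j⟩ : AffLinForm 1))
        (Set.Icc (fun _ : Fin 1 => (1 : ℝ)) (fun _ => (x : ℝ))) ≤ x := by
  rw [DimOne.archFactor_eq]
  set S := {r : ℝ | (fun _ : Fin 1 => r) ∈ Set.Icc (fun _ : Fin 1 => (1 : ℝ)) (fun _ => (x : ℝ)) ∧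
    ∀ j, 0 < ((fun j => (⟨fun _ => (1 : ℤ), h j⟩ : AffLinForm 1)) j).realEval fun _ => r}
    with hS
  have hTx : ((T : ℝ) + 1) ≤ x := by exact_mod_cast hx
  have hsub : Set.Ioc ((T : ℝ) + 1) x ⊆ S := by
    intro r hr
    rw [Set.mem_Ioc] at hr
    refine ⟨⟨fun _ => by linarith [hr.1, (Nat.cast_nonneg T : (0 : ℝ) ≤ T)], fun _ => hr.2⟩,
      fun j => ?_⟩
    rw [DimOne.realEval_eq]
    push_cast
    have hj : |((h j : ℤ) : ℝ)| ≤ T := by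
      rw [← Int.cast_abs, Int.abs_eq_natAbs]; exact_mod_cast hT j
    have := neg_abs_le ((h j : ℤ) : ℝ)
    linarith [hr.1]
  have hsup : S ⊆ Set.Icc (1 : ℝ) x := fun r hr => ⟨hr.1.1 0, hr.1.2 0⟩
  have hfin : volume S ≠ ⊤ :=
    (lt_of_le_of_lt (measure_mono hsup) (by rw [Real.volume_Icc]; exact ENNReal.ofReal_lt_top)).ne
  constructor
  · have hmono := ENNReal.toReal_mono hfin (measure_mono hsub)
    rwa [Real.volume_Ioc, ENNReal.toReal_ofReal (by linarith)] at hmono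
  · have hmono := ENNReal.toReal_mono (by rw [Real.volume_Icc]; exact ENNReal.ofReal_ne_top)
      (measure_mono hsup)
    rw [Real.volume_Icc, ENNReal.toReal_ofReal (by linarith [show (0 : ℝ) ≤ T from Nat.cast_nonneg T])] at hmono
    linarith

/-- **The prime tuple count is Green–Tao's prime-point count** of the translate system of `H` on
`K = [1, x]`: `π_H(x) = #{n ∈ [1, x] ∩ ℤ : n + hⱼ prime ∀ j}` (a prime value is positive, so the
positivity clause of `primeTupleCount` is automatic). [cite: HardyLittlewood1923, Conjecture B] -/
theorem primeTupleCount_eq_primePointCount (H : Finset ℤ) (x : ℕ) :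
    primeTupleCount H x = primePointCount (fun j : Fin H.card =>
        (⟨fun _ => (1 : ℤ), ((H.equivFin.symm j : H) : ℤ)⟩ : AffLinForm 1))
      (Set.Icc (fun _ : Fin 1 => (1 : ℝ)) (fun _ => (x : ℝ))) x := by
  have hev : ∀ (m : ℤ) (j : Fin H.card), ((fun j : Fin H.card =>
      (⟨fun _ => (1 : ℤ), ((H.equivFin.symm j : H) : ℤ)⟩ : AffLinForm 1)) j).eval (fun _ => m) =
        m + ((H.equivFin.symm j : H) : ℤ) := by
    intro m j
    rw [DimOne.eval_eq]
    simp
  -- both sides count integers `1 ≤ m ≤ x` with all `m + h` prime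
  have key : ∀ m : ℤ, (∀ y ∈ H, 0 < m + y ∧ (m + y).toNat.Prime) ↔
      ∀ j : Fin H.card, (m + ((H.equivFin.symm j : H) : ℤ)).toNat.Prime := by
    intro m
    constructor
    · intro hm j
      exact (hm _ (H.equivFin.symm j).2).2
    · intro hm y hy
      have hj := hm (H.equivFin ⟨y, hy⟩)
      simp only [Equiv.symm_apply_apply] at hj
      refine ⟨?_, hj⟩
      by_contra hle
      push Not at hle
      rw [Int.toNat_of_nonpos hle] at hj
      exact Nat.not_prime_zero hj
  unfold primeTupleCount primePointCount
  rw [DimOne.card_filter_latticeBox]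
  symm
  refine Finset.card_nbij' (fun m : ℤ => m.toNat) (fun n : ℕ => (n : ℤ)) (fun m hm => ?_)
    (fun n hn => ?_) (fun m hm => ?_) (fun n _ => by simp)
  · simp only [Finset.mem_coe, Finset.mem_filter, Finset.mem_Icc, DimOne.realPoint_const,
      Set.mem_Icc, Pi.le_def, hev] at hm ⊢
    obtain ⟨-, hK, hP⟩ := hm
    have h1 : (1 : ℝ) ≤ m := hK.1 0
    have h2 : (m : ℝ) ≤ x := hK.2 0
    have h1' : 1 ≤ m := by exact_mod_cast h1
    have h2' : m ≤ x := by exact_mod_cast h2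
    have hm0 : (m.toNat : ℤ) = m := Int.toNat_of_nonneg (by omega)
    have e1 : 1 ≤ m.toNat := by
      have : (1 : ℤ) ≤ (m.toNat : ℤ) := by rw [hm0]; exact h1'
      exact_mod_cast this
    have e2 : m.toNat ≤ x := by
      have : (m.toNat : ℤ) ≤ (x : ℤ) := by rw [hm0]; exact h2'
      exact_mod_cast this
    refine ⟨⟨e1, e2⟩, ?_⟩
    rw [hm0]
    exact (key m).mpr hP
  · simp only [Finset.mem_coe, Finset.mem_filter, Finset.mem_Icc, DimOne.realPoint_const,
      Set.mem_Icc, Pi.le_def, hev, Int.cast_natCast] at hn ⊢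
    obtain ⟨hn1, hP⟩ := hn
    refine ⟨⟨by omega, by omega⟩, ⟨fun _ => by exact_mod_cast hn1.1, fun _ => by exact_mod_cast hn1.2⟩,
      (key n).mp hP⟩
  · simp only [Finset.mem_coe, Finset.mem_filter, DimOne.realPoint_const, Set.mem_Icc,
      Pi.le_def] at hm
    obtain ⟨-, hK, -⟩ := hm
    have h1 : (1 : ℝ) ≤ m := hK.1 0
    have h1' : 1 ≤ m := by exact_mod_cast h1
    exact Int.toNat_of_nonneg (by omega)

end Summit.Parity.GeneralizedHardyLittlewood.Cruxes.PrimeCellsRelative.Sketch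

end
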